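import Mathlib

/-!
# Solo (blind) — Theorem A for two rays: the staircase bound in a product set

Context (KPTT 2015, §5, open problem 1: is `#vert Newt(fg+1) = O(t)` for `t`-sparse
`f, g ∈ ℂ[X,Y]`?).  After the reformulation `fg + 1 = (1 - G)(Ĝ - F)` with
`Ĝ = G/(1-G)` supported in the additive semigroup `S = sg(supp G)`, the inner vertices of
`Newt(fg+1)` for generic coefficients are south-west vertices of `S \ Z` for a finite
deleted set `Z`, and the conjectured bound ("Theorem A") reads
`#vertices(S \ Z) ≤ |Z| + ρ`, `ρ` = number of rays of `supp G`.

This file proves the case `ρ = 2` in the form it takes after the linear change of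
coordinates sending the two rays to the coordinate axes: the semigroup becomes a product
set `A₁ ×ˢ A₂ ⊆ ℕ × ℕ`, and for *any* `M ⊆ A₁ ×ˢ A₂` whose complement `D` in the product
is finite, the number of south-west exposed vertices of `M` is at most `|D| + 1`
(`D` contains the origin when `0 ∉ M`, so this is `|Z| + 2 = |Z| + ρ`).
The proof is the inner-corner injection `c ↦ (c.1, max {w.2 : w ∈ V, w.1 > c.1})`.
No semigroup structure is needed — only the product structure, which is exactly what
fails for three or more rays.
-/

namespace Summit.ValiantsHypothesis.ValiantsHypothesis.Theorems

/-! ### South-west exposed points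

`v` is a *south-west exposed vertex* of `M ⊆ ℕ × ℕ` when `v ∈ M` and some functional
`(a, b)` with `a, b < 0` is maximised over `M` at `v` only.  We keep this as an explicit
hypothesis `∃ a b, …` rather than a named predicate. -/

section SW

variable {M : Set (ℕ × ℕ)} {v w : ℕ × ℕ}

/-- No point of `M` other than `v` lies weakly south-west of an exposed vertex `v`. -/
lemma sw_false_of_le
    (hv : ∃ a b : ℚ, a < 0 ∧ b < 0 ∧
      ∀ w ∈ M, w ≠ v → a * (w.1 : ℚ) + b * (w.2 : ℚ) < a * (v.1 : ℚ) + b * (v.2 : ℚ))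
    (hw : w ∈ M) (hne : w ≠ v) (h1 : w.1 ≤ v.1) (h2 : w.2 ≤ v.2) : False := by
  obtain ⟨a, b, ha, hb, hmax⟩ := hv
  have hlt := hmax w hw hne
  have e1 : a * (v.1 : ℚ) ≤ a * (w.1 : ℚ) :=
    mul_le_mul_of_nonpos_left (by exact_mod_cast h1) ha.le
  have e2 : b * (v.2 : ℚ) ≤ b * (w.2 : ℚ) :=
    mul_le_mul_of_nonpos_left (by exact_mod_cast h2) hb.le
  linarith

/-- Two exposed vertices on the same vertical line coincide. -/
lemma sw_eq_of_fst_eq (hvM : v ∈ M)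
    (hv : ∃ a b : ℚ, a < 0 ∧ b < 0 ∧
      ∀ w ∈ M, w ≠ v → a * (w.1 : ℚ) + b * (w.2 : ℚ) < a * (v.1 : ℚ) + b * (v.2 : ℚ))
    (hwM : w ∈ M)
    (hw : ∃ a b : ℚ, a < 0 ∧ b < 0 ∧
      ∀ u ∈ M, u ≠ w → a * (u.1 : ℚ) + b * (u.2 : ℚ) < a * (w.1 : ℚ) + b * (w.2 : ℚ))
    (h : v.1 = w.1) : v = w := by
  by_contra hne
  rcases lt_trichotomy v.2 w.2 with hlt | heq | hgt
  · exact sw_false_of_le hw hvM hne h.le hlt.le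
  · exact hne (Prod.ext h heq)
  · exact sw_false_of_le hv hwM (Ne.symm hne) h.symm.le hgt.le

/-- Exposed vertices form a strictly decreasing staircase. -/
lemma sw_snd_lt_of_fst_lt (hvM : v ∈ M) (hwM : w ∈ M)
    (hw : ∃ a b : ℚ, a < 0 ∧ b < 0 ∧
      ∀ u ∈ M, u ≠ w → a * (u.1 : ℚ) + b * (u.2 : ℚ) < a * (w.1 : ℚ) + b * (w.2 : ℚ))
    (h : v.1 < w.1) : w.2 < v.2 := by
  by_contra hle
  rw [not_lt] at hle
  have hne : v ≠ w := by
    intro e; rw [e] at h; exact lt_irrefl _ h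
  have _ := hwM
  exact sw_false_of_le hw hvM hne h.le hle

end SW

open Finset

/-- **Theorem A for two rays (product form).**  If `M ⊆ A₁ ×ˢ A₂`, every point of the
product outside `M` belongs to the finite set `D`, and `V` is a finite set of south-west
exposed vertices of `M`, then `|V| ≤ |D| + 1`. -/
theorem card_swVertices_le_card_add_one (A₁ A₂ : Set ℕ) (M : Set (ℕ × ℕ))
    (hM : M ⊆ A₁ ×ˢ A₂) (D : Finset (ℕ × ℕ))
    (hD : ∀ p : ℕ × ℕ, p ∈ A₁ ×ˢ A₂ → p ∉ M → p ∈ D)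
    (V : Finset (ℕ × ℕ)) (hVM : ∀ v ∈ V, v ∈ M)
    (hV : ∀ v ∈ V, ∃ a b : ℚ, a < 0 ∧ b < 0 ∧
      ∀ w ∈ M, w ≠ v → a * (w.1 : ℚ) + b * (w.2 : ℚ) < a * (v.1 : ℚ) + b * (v.2 : ℚ)) :
    V.card ≤ D.card + 1 := by
  classical
  rcases V.eq_empty_or_nonempty with hVe | hne
  · simp [hVe]
  -- the last vertex (largest first coordinate)
  obtain ⟨vmax, hvmaxV, hvmax⟩ := exists_max_image V Prod.fst hne
  -- later vertices of `c`
  let T : ℕ × ℕ → Finset (ℕ × ℕ) := fun c => V.filter (fun w => c.1 < w.1)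
  -- the inner-corner map
  let f : ℕ × ℕ → ℕ × ℕ := fun c =>
    if h : (T c).Nonempty then (c.1, (T c).sup' h Prod.snd) else c
  have hT : ∀ c ∈ V.erase vmax, (T c).Nonempty := by
    intro c hc
    rw [mem_erase] at hc
    refine ⟨vmax, ?_⟩
    simp only [T, mem_filter]
    refine ⟨hvmaxV, lt_of_le_of_ne (hvmax c hc.2) ?_⟩
    intro h
    exact hc.1 (sw_eq_of_fst_eq (hVM c hc.2) (hV c hc.2) (hVM vmax hvmaxV) (hV vmax hvmaxV) h)
  have hf1 : ∀ c ∈ V.erase vmax, (f c).1 = c.1 := by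
    intro c hc
    simp only [f, dif_pos (hT c hc)]
  have hfD : ∀ c ∈ V.erase vmax, f c ∈ D := by
    intro c hc
    have hTc := hT c hc
    have hcV : c ∈ V := (mem_erase.mp hc).2
    -- the sup is attained at some later vertex `w₀`
    obtain ⟨w₀, hw₀T, hw₀⟩ := exists_mem_eq_sup' hTc Prod.snd
    have hw₀V : w₀ ∈ V := (mem_filter.mp hw₀T).1
    have hw₀lt : c.1 < w₀.1 := (mem_filter.mp hw₀T).2
    have hy : (T c).sup' hTc Prod.snd < c.2 := by
      rw [hw₀]; exact sw_snd_lt_of_fst_lt (hVM c hcV) (hVM w₀ hw₀V) (hV w₀ hw₀V) hw₀lt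
    have hfc : f c = (c.1, (T c).sup' hTc Prod.snd) := by
      simp only [f, dif_pos hTc]
    apply hD
    · -- membership in the product
      rw [hfc]
      have hcA : c ∈ A₁ ×ˢ A₂ := hM (hVM c hcV)
      have hwA : w₀ ∈ A₁ ×ˢ A₂ := hM (hVM w₀ hw₀V)
      rw [Set.mem_prod] at hcA hwA ⊢
      exact ⟨hcA.1, by rw [hw₀]; exact hwA.2⟩
    · -- not in `M`: it would beat `c` for `c`'s own functional
      intro hfM
      rw [hfc] at hfM
      have hne : ((c.1, (T c).sup' hTc Prod.snd) : ℕ × ℕ) ≠ c := by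
        intro e
        have := congrArg Prod.snd e
        simp only at this
        rw [this] at hy
        exact lt_irrefl _ hy
      exact sw_false_of_le (hV c hcV) hfM hne le_rfl hy.le
  have hinj : Set.InjOn f ↑(V.erase vmax) := by
    intro c hc c' hc' he
    have hcV : c ∈ V := (mem_erase.mp hc).2
    have hc'V : c' ∈ V := (mem_erase.mp hc').2
    have h1 : c.1 = c'.1 := by
      have := congrArg Prod.fst he
      rwa [hf1 c hc, hf1 c' hc'] at this
    exact sw_eq_of_fst_eq (hVM c hcV) (hV c hcV) (hVM c' hc'V) (hV c' hc'V) h1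
  have hcard : (V.erase vmax).card ≤ D.card :=
    card_le_card_of_injOn f (fun c hc => hfD c hc) hinj
  have := card_erase_add_one hvmaxV
  omega

end Summit.ValiantsHypothesis.ValiantsHypothesis.Theorems
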